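import Summits.Ventures.LatticeQCDFlow.Exactness.IMHCoupledUnbiasedEstimatorUnboundedWeights
import HarnessLib

/-!
# The second-moment condition is sharp: beside a stationary run, the expected total disagreement time of the coupled exact sampler is
# finite if and only if `∫ w dπ = ∫ w² dq < ∞` — i.e. iff the flow's importance-sampling effective sample size is positive

HONEST FRAMING: exact (Metropolis-corrected) sampling algorithms for lattice gauge theory;
figures of merit are autocorrelation/cost numbers at stated couplings and volumes; no
continuum-physics claim.

Venture `LatticeQCDFlow` (cell pub-lqcd), topic `Exactness`; FANOUT row 30 (lean-1, GEN-40).  NEW WORK of the cell (standard Borel `Ω`,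
`MeasurableEq Ω`; every proposal law — atoms allowed, via this generation's `…AnyCouplingAtoms`); sequel to this generation's unbounded-weight files (`…MeetingTimeUnboundedWeights`: from every
coupling `Σ_n P(X_n ≠ X′_n) ≤ E[max(1, w, w′); Δᶜ]/E_q[min(1, w)]`; `…CoupledUnbiasedEstimatorUnboundedWeights`: exact unbiasedness when
`∫ w² dq < ∞`; `…FlowDivergenceDictionary`: `∫ w² dq = 1 + χ²(π‖q) = 1/ESS`) and to GEN-39's any-coupling IDENTITY
`Σ_n P(X_n ≠ X′_n) = E[1/A(heavier start); X_0 ≠ X′_0]`.  The upper bounds of this generation pay `∫ w² dq`; here the converse: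
`A(y) ≤ 1/w(y)` (row 30's `imhAcceptMass_le`, 2026-08-21), so the heavier start holds for `≥ w(heavier)` rounds in expectation.  Setting:
`K = indepMH q w`, `0 < w` measurable, `π = w·q` a probability law, NO bound on `w`; CRN pair kernel `K̂`; THE WITNESS COUPLING
`μ̂₀ = π ⊗ δ_x` (a stationary run beside the production run from `x`):

* §1 **`ofReal_weight_le_inv_imhAcceptMass`** — `w(y) ≤ 1/A(y)` (`ℝ≥0∞`); **`setLIntegral_weight_le_tsum_offDiagonal`** — for EVERY coupling,
  `∫_{w(p.2) ≤ w(p.1)} ∖ Δ w(p.1) dμ̂₀ ≤ Σ_n (μ̂₀K̂ⁿ)(Δᶜ)`: the series is at least the mean weight of the heavier start.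
* §2 **`setLIntegral_weight_le_tsum_offDiagonal_stationaryStart`** — for `μ̂₀ = π ⊗ δ_x`: `∫_{w ≥ w(x)} ∖ {x} w dπ ≤ Σ_n (μ̂₀K̂ⁿ)(Δᶜ)`;
  **`tsum_offDiagonal_stationaryStart_eq_top`** — if `∫ w dπ = ∞` then `Σ_n P(X_n ≠ X′_n) = ∞`: THE COUPLED ESTIMATOR'S EXPECTED COST IS INFINITE
  FOR A FLOW OF ZERO EFFECTIVE SAMPLE SIZE (from the target; the production run at any `x`);
  **`tsum_offDiagonal_stationaryStart_lt_top_iff`** — THE DICHOTOMY: `Σ_n P(X_n ≠ X′_n) < ∞ ↔ ∫ w dπ < ∞` (`↔ ∫ w² dq < ∞ ↔ ESS > 0`).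
Reading (gauge files): for the flow-driven exact gauge sampler coupled beside an equilibrium run, the expected number of rounds on which the two
runs differ is finite exactly when the flow's importance-sampling effective sample size is positive.
CONTRAST: from the PRACTICAL start `K(x, ·) ⊗ δ_x` (production run at `x`, leading run one update ahead) the expected total disagreement time is
ALWAYS finite, `≤ (max(1, w(x)) + 1)/E_q[min(1, w)]` (`…MeetingTimeUnboundedWeights` §4) — the dichotomy typed here is a statement about STATIONARY starts:
the effective sample size governs the equilibrium pair, not the practical one.  NOT CLAIMED: almost-sure (rather than mean) statements.  No `sorry`,
no new definitions, nothing cited as a fact.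
-/

noncomputable section

namespace Summit.Ventures.LatticeQCDFlow.Exactness

open MeasureTheory ProbabilityTheory Function Finset Filter Set
open scoped _root_.ENNReal unitInterval Topology
open Summit.Ventures.LatticeQCDFlow.Scoring

variable {Ω : Type*} [MeasurableSpace Ω] {q : Measure Ω} [IsProbabilityMeasure q] {w : Ω → ℝ}

/-! ## §1 The heavier start holds for at least its weight, in expectation -/

omit [IsProbabilityMeasure q] in
/-- **`w(y) ≤ 1/A(y)`** for a probability target `π = w·q` (`A(y) ≤ (∫ w dq)/w(y) = 1/w(y)`; `ℝ≥0∞`). [ours] -/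
theorem ofReal_weight_le_inv_imhAcceptMass (hw0 : ∀ y, 0 < w y)
    [IsProbabilityMeasure (q.withDensity fun y => ENNReal.ofReal (w y))] (y : Ω) :
    ENNReal.ofReal (w y) ≤ (imhAcceptMass q w y)⁻¹ := by
  have h1 : ∫⁻ z, ENNReal.ofReal (w z) ∂q = 1 := by
    have := (measure_univ : (q.withDensity fun y => ENNReal.ofReal (w y)) Set.univ = 1)
    rwa [withDensity_apply _ MeasurableSet.univ, Measure.restrict_univ] at this
  have hA : imhAcceptMass q w y ≤ (ENNReal.ofReal (w y))⁻¹ := by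
    have h := imhAcceptMass_le (q := q) hw0 y
    rwa [h1, mul_one, ENNReal.ofReal_inv_of_pos (hw0 y)] at h
  have := ENNReal.inv_le_inv.2 hA
  rwa [inv_inv] at this

/-- **THE SERIES IS AT LEAST THE MEAN WEIGHT OF THE HEAVIER START**: for every finite coupling `μ̂₀` (standard Borel `Ω`, every proposal law),
`∫_{w(p.2) ≤ w(p.1)} ∖ Δ w(p.1) dμ̂₀ ≤ Σ_n (μ̂₀K̂ⁿ)(Δᶜ)`. [ours] -/
theorem setLIntegral_weight_le_tsum_offDiagonal [StandardBorelSpace Ω] [Nonempty Ω] [MeasurableSingletonClass Ω] [MeasurableEq Ω]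
    (hw : Measurable w) (hw0 : ∀ y, 0 < w y)
    [IsProbabilityMeasure (q.withDensity fun y => ENNReal.ofReal (w y))]
    (Khat : Kernel (Ω × Ω) (Ω × Ω)) [IsMarkovKernel Khat]
    (hK : ∀ z : Ω × Ω, Khat z = (q.prod (volume : Measure unitInterval)).map (fun p : Ω × unitInterval =>
      ((if (p.2 : ℝ) * w z.1 ≤ w p.1 then p.1 else z.1), (if (p.2 : ℝ) * w z.2 ≤ w p.1 then p.1 else z.2))))
    (μ₀ : Measure (Ω × Ω)) [IsFiniteMeasure μ₀] :
    ∫⁻ p in {p : Ω × Ω | w p.2 ≤ w p.1} ∩ (Set.diagonal Ω)ᶜ, ENNReal.ofReal (w p.1) ∂μ₀ ≤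
      ∑' n, ((fun m : Measure (Ω × Ω) => m.bind Khat)^[n] μ₀) (Set.diagonal Ω)ᶜ := by
  rw [tsum_iterate_bind_crnPair_offDiagonal_eq_anyCoupling_atoms hw hw0 Khat hK μ₀]
  have h1 : ∫⁻ p in {p : Ω × Ω | w p.2 ≤ w p.1} ∩ (Set.diagonal Ω)ᶜ, ENNReal.ofReal (w p.1) ∂μ₀ ≤
      ∫⁻ p in {p : Ω × Ω | w p.2 ≤ w p.1} ∩ (Set.diagonal Ω)ᶜ, (imhAcceptMass q w p.1)⁻¹ ∂μ₀ :=
    lintegral_mono fun p => ofReal_weight_le_inv_imhAcceptMass hw0 p.1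
  exact h1.trans le_self_add

/-! ## §2 The witness coupling `π ⊗ δ_x`: the dichotomy -/

/-- **`∫_{w ≥ w(x)} ∖ {x} w dπ ≤ Σ_n P(X_n ≠ X′_n)`** for the stationary-start witness coupling `μ̂₀ = π ⊗ δ_x`. [ours] -/
theorem setLIntegral_weight_le_tsum_offDiagonal_stationaryStart [StandardBorelSpace Ω] [Nonempty Ω] [MeasurableSingletonClass Ω]
    [MeasurableEq Ω] (hw : Measurable w) (hw0 : ∀ y, 0 < w y)
    [IsProbabilityMeasure (q.withDensity fun y => ENNReal.ofReal (w y))]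
    (Khat : Kernel (Ω × Ω) (Ω × Ω)) [IsMarkovKernel Khat]
    (hK : ∀ z : Ω × Ω, Khat z = (q.prod (volume : Measure unitInterval)).map (fun p : Ω × unitInterval =>
      ((if (p.2 : ℝ) * w z.1 ≤ w p.1 then p.1 else z.1), (if (p.2 : ℝ) * w z.2 ≤ w p.1 then p.1 else z.2))))
    (x : Ω) :
    ∫⁻ y in {y | w x ≤ w y} ∩ {x}ᶜ, ENNReal.ofReal (w y) ∂(q.withDensity fun y => ENNReal.ofReal (w y)) ≤
      ∑' n, ((fun m : Measure (Ω × Ω) => m.bind Khat)^[n] ((q.withDensity fun y => ENNReal.ofReal (w y)).prod (Measure.dirac x)))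
        (Set.diagonal Ω)ᶜ := by
  set π : Measure Ω := q.withDensity fun y => ENNReal.ofReal (w y) with hπ
  have hD : MeasurableSet (Set.diagonal Ω) := measurableSet_diagonal
  have hOm : MeasurableSet {p : Ω × Ω | w p.2 ≤ w p.1} := measurableSet_le (hw.comp measurable_snd) (hw.comp measurable_fst)
  have hφ : Measurable fun y : Ω => (y, x) := measurable_id.prodMk measurable_const
  have hpre : (fun y : Ω => (y, x)) ⁻¹' ({p : Ω × Ω | w p.2 ≤ w p.1} ∩ (Set.diagonal Ω)ᶜ) = {y | w x ≤ w y} ∩ {x}ᶜ := by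
    ext y; simp [Set.mem_diagonal_iff]
  have h := setLIntegral_weight_le_tsum_offDiagonal hw hw0 Khat hK (π.prod (Measure.dirac x))
  have hm1 : Measurable fun p : Ω × Ω => ENNReal.ofReal (w p.1) := (hw.comp measurable_fst).ennreal_ofReal
  rw [Measure.prod_dirac, setLIntegral_map (hOm.inter hD.compl) hm1 hφ, hpre] at h
  rw [Measure.prod_dirac]
  exact h

/-- **ZERO EFFECTIVE SAMPLE SIZE ⇒ INFINITE EXPECTED COST**: if `∫ w dπ = ∞` (i.e. `∫ w² dq = ∞`), then for the witness coupling `π ⊗ δ_x`,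
`Σ_n P(X_n ≠ X′_n) = ∞` — from every `x`. [ours] -/
theorem tsum_offDiagonal_stationaryStart_eq_top [StandardBorelSpace Ω] [Nonempty Ω] [MeasurableSingletonClass Ω]
    [MeasurableEq Ω] (hw : Measurable w) (hw0 : ∀ y, 0 < w y)
    [IsProbabilityMeasure (q.withDensity fun y => ENNReal.ofReal (w y))]
    (Khat : Kernel (Ω × Ω) (Ω × Ω)) [IsMarkovKernel Khat]
    (hK : ∀ z : Ω × Ω, Khat z = (q.prod (volume : Measure unitInterval)).map (fun p : Ω × unitInterval =>
      ((if (p.2 : ℝ) * w z.1 ≤ w p.1 then p.1 else z.1), (if (p.2 : ℝ) * w z.2 ≤ w p.1 then p.1 else z.2))))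
    (x : Ω) (hπw : ∫⁻ y, ENNReal.ofReal (w y) ∂(q.withDensity fun y => ENNReal.ofReal (w y)) = ∞) :
    ∑' n, ((fun m : Measure (Ω × Ω) => m.bind Khat)^[n] ((q.withDensity fun y => ENNReal.ofReal (w y)).prod (Measure.dirac x)))
        (Set.diagonal Ω)ᶜ = ∞ := by
  set π : Measure Ω := q.withDensity fun y => ENNReal.ofReal (w y) with hπ
  have hg : Measurable fun y : Ω => ENNReal.ofReal (w y) := hw.ennreal_ofReal
  have hL : MeasurableSet {y | w x ≤ w y} := measurableSet_le measurable_const hw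
  -- the light part and the atom at `x` carry finite weight; the heavy part is everything else
  have hlight : ∫⁻ y in {y | w x ≤ w y}ᶜ, ENNReal.ofReal (w y) ∂π ≤ ENNReal.ofReal (w x) := by
    calc ∫⁻ y in {y | w x ≤ w y}ᶜ, ENNReal.ofReal (w y) ∂π ≤ ∫⁻ _ in {y | w x ≤ w y}ᶜ, ENNReal.ofReal (w x) ∂π :=
          setLIntegral_mono' hL.compl fun y hy => ENNReal.ofReal_le_ofReal (le_of_lt (not_le.1 hy))
      _ ≤ ENNReal.ofReal (w x) := by
          rw [setLIntegral_const]
          exact mul_le_of_le_one_right' prob_le_one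
  have hxfin : ∫⁻ y in {x}, ENNReal.ofReal (w y) ∂π ≠ ∞ := by
    rw [Measure.restrict_singleton, lintegral_smul_measure, lintegral_dirac' _ hg]
    exact ENNReal.mul_ne_top (measure_ne_top π _) ENNReal.ofReal_ne_top
  have hsplit : ∫⁻ y, ENNReal.ofReal (w y) ∂π ≤
      ∫⁻ y in {y | w x ≤ w y} ∩ {x}ᶜ, ENNReal.ofReal (w y) ∂π + ∫⁻ y in {y | w x ≤ w y}ᶜ, ENNReal.ofReal (w y) ∂π +
        ∫⁻ y in {x}, ENNReal.ofReal (w y) ∂π := by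
    have hcover : (Set.univ : Set Ω) ⊆ ({y | w x ≤ w y} ∩ {x}ᶜ ∪ {y | w x ≤ w y}ᶜ) ∪ {x} := by
      intro y _
      by_cases hyx : y = x
      · exact Or.inr hyx
      · by_cases hyw : w x ≤ w y
        · exact Or.inl (Or.inl ⟨hyw, hyx⟩)
        · exact Or.inl (Or.inr hyw)
    calc ∫⁻ y, ENNReal.ofReal (w y) ∂π = ∫⁻ y in Set.univ, ENNReal.ofReal (w y) ∂π := by rw [Measure.restrict_univ]
      _ ≤ ∫⁻ y in ({y | w x ≤ w y} ∩ {x}ᶜ ∪ {y | w x ≤ w y}ᶜ) ∪ {x}, ENNReal.ofReal (w y) ∂π := lintegral_mono_set hcover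
      _ ≤ ∫⁻ y in {y | w x ≤ w y} ∩ {x}ᶜ ∪ {y | w x ≤ w y}ᶜ, ENNReal.ofReal (w y) ∂π + ∫⁻ y in {x}, ENNReal.ofReal (w y) ∂π :=
          lintegral_union_le _ _ _
      _ ≤ _ := add_le_add (lintegral_union_le _ _ _) le_rfl
  -- hence the heavy part is infinite
  have hheavy : ∫⁻ y in {y | w x ≤ w y} ∩ {x}ᶜ, ENNReal.ofReal (w y) ∂π = ∞ := by
    by_contra hne
    have hfin : ∫⁻ y in {y | w x ≤ w y} ∩ {x}ᶜ, ENNReal.ofReal (w y) ∂π + ∫⁻ y in {y | w x ≤ w y}ᶜ, ENNReal.ofReal (w y) ∂π +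
        ∫⁻ y in {x}, ENNReal.ofReal (w y) ∂π ≠ ∞ :=
      ENNReal.add_ne_top.2 ⟨ENNReal.add_ne_top.2 ⟨hne, ne_top_of_le_ne_top ENNReal.ofReal_ne_top hlight⟩, hxfin⟩
    exact hfin (eq_top_iff.2 (hπw ▸ hsplit))
  exact eq_top_iff.2 (hheavy ▸ setLIntegral_weight_le_tsum_offDiagonal_stationaryStart hw hw0 Khat hK x)

/-- **THE DICHOTOMY**: for the witness coupling `π ⊗ δ_x` (stationary run beside the production run from `x`),
`Σ_n P(X_n ≠ X′_n) < ∞ ↔ ∫ w dπ < ∞` — the coupled exact sampler's expected total disagreement time is finite EXACTLY when the flow has a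
positive importance-sampling effective sample size (`∫ w dπ = ∫ w² dq = 1/ESS`). [ours] -/
theorem tsum_offDiagonal_stationaryStart_lt_top_iff [StandardBorelSpace Ω] [Nonempty Ω] [MeasurableSingletonClass Ω]
    [MeasurableEq Ω] (hw : Measurable w) (hw0 : ∀ y, 0 < w y)
    [IsProbabilityMeasure (q.withDensity fun y => ENNReal.ofReal (w y))]
    (Khat : Kernel (Ω × Ω) (Ω × Ω)) [IsMarkovKernel Khat]
    (hK : ∀ z : Ω × Ω, Khat z = (q.prod (volume : Measure unitInterval)).map (fun p : Ω × unitInterval =>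
      ((if (p.2 : ℝ) * w z.1 ≤ w p.1 then p.1 else z.1), (if (p.2 : ℝ) * w z.2 ≤ w p.1 then p.1 else z.2))))
    (x : Ω) :
    ∑' n, ((fun m : Measure (Ω × Ω) => m.bind Khat)^[n] ((q.withDensity fun y => ENNReal.ofReal (w y)).prod (Measure.dirac x)))
        (Set.diagonal Ω)ᶜ < ∞ ↔
      ∫⁻ y, ENNReal.ofReal (w y) ∂(q.withDensity fun y => ENNReal.ofReal (w y)) < ∞ := by
  set π : Measure Ω := q.withDensity fun y => ENNReal.ofReal (w y) with hπ
  constructor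
  · intro h
    by_contra hinf
    rw [not_lt, top_le_iff] at hinf
    rw [tsum_offDiagonal_stationaryStart_eq_top hw hw0 Khat hK x hinf] at h
    exact lt_irrefl _ h
  · intro h
    have hc0 : ∫⁻ y, ENNReal.ofReal (min 1 (w y)) ∂q ≠ 0 := by
      intro h0
      have hae : (fun y => ENNReal.ofReal (min 1 (w y))) =ᵐ[q] 0 :=
        (lintegral_eq_zero_iff (measurable_const.min hw).ennreal_ofReal).1 h0
      have hfalse : ∀ᵐ y ∂q, False := hae.mono fun y hy => by
        have hpos : 0 < ENNReal.ofReal (min 1 (w y)) := ENNReal.ofReal_pos.2 (lt_min one_pos (hw0 y))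
        simp only [Pi.zero_apply] at hy
        exact hpos.ne' hy
      rw [ae_iff] at hfalse
      simp at hfalse
    have hfin : ∫⁻ p in (Set.diagonal Ω)ᶜ, ENNReal.ofReal (max 1 (max (w p.1) (w p.2))) ∂(π.prod (Measure.dirac x)) ≠ ∞ := by
      refine ne_top_of_le_ne_top ?_ (lintegral_offDiagonal_prod_le hw hw0 π (Measure.dirac x))
      rw [lintegral_dirac' _ hw.ennreal_ofReal]
      exact ENNReal.add_ne_top.2 ⟨ENNReal.add_ne_top.2 ⟨ENNReal.one_ne_top, h.ne⟩, ENNReal.ofReal_ne_top⟩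
    exact lt_of_le_of_lt (tsum_offDiagonal_le_unboundedWeights hw hw0 Khat hK _) (ENNReal.div_lt_top hfin hc0)

end Summit.Ventures.LatticeQCDFlow.Exactness

end
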